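import Summits.ValiantsHypothesis.ValiantsHypothesis.Theorems.MonotoneRestorationOrbitRestorationQPSymmetricModelOffset
import HarnessLib

/-!
# Route MonotoneRestoration — crux `OrbitRestorationQP` (stmt-ValiantsHypothesis-18293), line `depth_three_rung`:
# the symmetric-model sub-rung of `A_∞` — EVEN/ODD MOMENT CALCULUS: sign-twisted linear frames restore

Helper file (`--supports stmt-ValiantsHypothesis-18293`), def-free.  Namespace
`Summit.ValiantsHypothesis.ValiantsHypothesis.Theorems.OrbitRestorationQPDepthThreeRung.SymmetricModel` (continued).

`…SymmetricModelMoments.lean` restores `a · e_d(Λ)` when ALL moments `p_1(Λ), …, p_d(Λ)` are matrix-symmetric.  For the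
residue of the symmetric-model rung — homogeneous LINEAR frames `Λ = (ℓ_{w_i})_{i<m}` — the first obstruction met by the
landed A₁ (twisted factor multisets, sign characters: `V_n = Π_{P<Q}(x_P − x_Q)`) reappears as frames whose ODD moments are
only RELATIVE invariants (e.g. `g·p_j = χ(g)^j p_j` for a `±1`-valued character `χ` of `Sym_n × Sym_n`).  This file disposes
of it for even `d`:

* `parityNewton` — PARITY-REFINED NEWTON in `ℂ[y_1, …, y_m]`: if a subalgebra `A` contains the even power sums `p_j`
  (`j ≤ d` even) and the products `p_j p_{j'}` of odd power sums (`j, j' ≤ d` odd), then `e_k ∈ A` for every EVEN `k ≤ d`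
  (and `e_k ∈ A·{p_j : j odd}` for odd `k`) — simultaneous strong induction on Mathlib's `mul_esymm_eq_sum`;
* `esymm_frame_mem_adjoin_evenOdd` — transported to a frame: for even `d`, `e_d(Λ) ∈ ℂ[p_j(Λ) (j even), p_j(Λ)p_{j'}(Λ) (j, j' odd)]`;
* `derivChain_momentProduct_le`, `finrank_derivChain_momentProduct_le` — the derivative chain of a product of two
  moments `p_j(Λ) p_{j'}(Λ)` lies in `span{ℓ_{w_i}^p ℓ_{w_{i'}}^q : p ≤ j, q ≤ j'}`, of dimension `≤ m²(j+1)(j'+1)`;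
* `qpOrbitRestorable_momentProduct` — a matrix-symmetric product of two moments of a linear frame restores, uniformly
  (the landed UNCONDITIONAL polynomial-catalecticant theorem `DerivativeTower.qpOrbitRestorable_of_smallDerivChain` fed by
  `AltFix.smallModules_altSpanning`, at one level; invariant fallback below the threshold);
* ★ `qpOrbitRestorable_esymm_of_evenOddMoments` — **SIGN-TWISTED FRAMES RESTORE**: for every `c` there is `c'` such that for
  all `n`, every linear frame `Λ` of size `m` with `(m+1)^4 ≤ n^c + c`, every EVEN `d` and every `a`: if the even moments
  `p_j(Λ)` (`j ≤ d` even) and the products of odd moments `p_j(Λ) p_{j'}(Λ)` (`j, j' ≤ d` odd) are matrix-symmetric, then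
  `a · e_d(Λ)` is `QPOrbitRestorable c' n`.  In particular frames on which `Sym_n × Sym_n` acts through a sign character
  (`g·Λ = χ(g)·Λ` as multisets, `χ = ±1`) restore in every even degree — no invariance of any odd moment is needed.

Honest label: a sub-rung theorem (the character obstruction of the symmetric-model rung, linear frames, even degree);
no registered stub is closed; A_∞, the crux and VP ≠ VNP are NOT moved.

v2 (appended): `pbound_succ_pow_four` (`(n^c + c + 1)^4 ≤ n^{(c+2)^4} + (c+2)^4`) and the corollary
`qpOrbitRestorable_esymm_of_evenOddMoments'` (the same theorem with the usual frame budget `m ≤ n^c + c`).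

## References
* A. Shpilka, *Affine projections of symmetric polynomials*, J. Comput. System Sci. 65 (2002) 639–659, Thm 3.1, §5. [Shpilka2002]
* A. Dawar, G. Wilsenach, *Symmetric arithmetic circuits*, ToC 21 (2025), §3.3 (ORB). [DawarWilsenach2025]
-/

noncomputable section

open scoped Classical

-- `Summit.ValiantsHypothesis.ValiantsHypothesis.…` is the tree's single-conjunct layout (Sub = Summit).
set_option linter.dupNamespace false

namespace Summit.ValiantsHypothesis.ValiantsHypothesis.Theorems

namespace OrbitRestorationQPDepthThreeRung

namespace SymmetricModel

open MvPolynomial Finset Equiv WaringJennrich LevelStructure ProductAction DerivativeTower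

variable {n : ℕ}

/-! ### Parity-refined Newton identities -/

section ParityNewton

variable {m d : ℕ} (A : Subalgebra ℂ (MvPolynomial (Fin m) ℂ))

/-- Scalar powers of `-1` times members of a submodule stay in the submodule. [folklore] -/
theorem neg_one_pow_mul_mem_submodule (M : Submodule ℂ (MvPolynomial (Fin m) ℂ)) (i : ℕ)
    {x : MvPolynomial (Fin m) ℂ} (hx : x ∈ M) : (-1 : MvPolynomial (Fin m) ℂ) ^ i * x ∈ M := by
  have h : ((-1 : MvPolynomial (Fin m) ℂ) ^ i) = C ((-1 : ℂ) ^ i) := by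
    rw [map_pow, map_neg, map_one]
  rw [h, ← smul_eq_C_mul]
  exact M.smul_mem _ hx

/-- The odd companion module: the `ℂ`-span of `a · p_j` with `a ∈ A` and `j ≤ d` odd is closed under multiplication by
`A`. [folklore] -/
theorem mul_mem_oddSpan {a q : MvPolynomial (Fin m) ℂ} (ha : a ∈ A)
    (hq : q ∈ Submodule.span ℂ {q : MvPolynomial (Fin m) ℂ | ∃ b ∈ A, ∃ j : ℕ, Odd j ∧ j ≤ d ∧ q = b * psum (Fin m) ℂ j}) :
    a * q ∈ Submodule.span ℂ {q : MvPolynomial (Fin m) ℂ | ∃ b ∈ A, ∃ j : ℕ, Odd j ∧ j ≤ d ∧ q = b * psum (Fin m) ℂ j} := by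
  induction hq using Submodule.span_induction with
  | mem x hx =>
    obtain ⟨b, hb, j, hj, hjd, rfl⟩ := hx
    refine Submodule.subset_span ⟨a * b, A.mul_mem ha hb, j, hj, hjd, ?_⟩
    ring
  | zero => rw [mul_zero]; exact Submodule.zero_mem _
  | add x y _ _ hx hy => rw [mul_add]; exact Submodule.add_mem _ hx hy
  | smul r x _ hx => rw [mul_smul_comm]; exact Submodule.smul_mem _ _ hx

/-- Odd span times an odd power sum lands in `A` (when `A` contains the products of odd power sums). [folklore] -/
theorem oddSpan_mul_psum_odd (hP : ∀ j j' : ℕ, Odd j → Odd j' → j ≤ d → j' ≤ d →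
      psum (Fin m) ℂ j * psum (Fin m) ℂ j' ∈ A)
    {q : MvPolynomial (Fin m) ℂ}
    (hq : q ∈ Submodule.span ℂ {q : MvPolynomial (Fin m) ℂ | ∃ b ∈ A, ∃ j : ℕ, Odd j ∧ j ≤ d ∧ q = b * psum (Fin m) ℂ j})
    {j : ℕ} (hj : Odd j) (hjd : j ≤ d) : q * psum (Fin m) ℂ j ∈ A := by
  induction hq using Submodule.span_induction with
  | mem x hx =>
    obtain ⟨b, hb, j', hj', hj'd, rfl⟩ := hx
    rw [mul_assoc]
    exact A.mul_mem hb (hP j' j hj' hj hj'd hjd)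
  | zero => rw [zero_mul]; exact A.zero_mem
  | add x y _ _ hx hy => rw [add_mul]; exact A.add_mem hx hy
  | smul r x _ hx => rw [smul_mul_assoc]; exact A.smul_mem hx r

/-- Odd span times an even power sum stays in the odd span (when `A` contains the even power sums). [folklore] -/
theorem oddSpan_mul_psum_even (hE : ∀ j : ℕ, Even j → 1 ≤ j → j ≤ d → psum (Fin m) ℂ j ∈ A)
    {q : MvPolynomial (Fin m) ℂ}
    (hq : q ∈ Submodule.span ℂ {q : MvPolynomial (Fin m) ℂ | ∃ b ∈ A, ∃ j : ℕ, Odd j ∧ j ≤ d ∧ q = b * psum (Fin m) ℂ j})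
    {j : ℕ} (hj : Even j) (hj1 : 1 ≤ j) (hjd : j ≤ d) :
    q * psum (Fin m) ℂ j ∈
      Submodule.span ℂ {q : MvPolynomial (Fin m) ℂ | ∃ b ∈ A, ∃ j : ℕ, Odd j ∧ j ≤ d ∧ q = b * psum (Fin m) ℂ j} := by
  induction hq using Submodule.span_induction with
  | mem x hx =>
    obtain ⟨b, hb, j', hj', hj'd, rfl⟩ := hx
    refine Submodule.subset_span ⟨b * psum (Fin m) ℂ j, A.mul_mem hb (hE j hj hj1 hjd), j', hj', hj'd, ?_⟩
    ring
  | zero => rw [zero_mul]; exact Submodule.zero_mem _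
  | add x y _ _ hx hy => rw [add_mul]; exact Submodule.add_mem _ hx hy
  | smul r x _ hx => rw [smul_mul_assoc]; exact Submodule.smul_mem _ _ hx

/-- **PARITY-REFINED NEWTON.**  Let `A ⊆ ℂ[y_1, …, y_m]` be a subalgebra containing the even power sums `p_j` (`j ≤ d`
even) and the products `p_j p_{j'}` of odd power sums (`j, j' ≤ d` odd).  Then for every `k ≤ d`: if `k` is even,
`e_k ∈ A`; if `k` is odd, `e_k ∈ span_ℂ (A · {p_j : j ≤ d odd})`. [folklore; cite: Shpilka2002, §5] -/
theorem parityNewton (hE : ∀ j : ℕ, Even j → 1 ≤ j → j ≤ d → psum (Fin m) ℂ j ∈ A)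
    (hP : ∀ j j' : ℕ, Odd j → Odd j' → j ≤ d → j' ≤ d → psum (Fin m) ℂ j * psum (Fin m) ℂ j' ∈ A) :
    ∀ k : ℕ, k ≤ d →
      (Even k → esymm (Fin m) ℂ k ∈ A) ∧
      (Odd k → esymm (Fin m) ℂ k ∈
        Submodule.span ℂ {q : MvPolynomial (Fin m) ℂ | ∃ b ∈ A, ∃ j : ℕ, Odd j ∧ j ≤ d ∧ q = b * psum (Fin m) ℂ j}) := by
  intro k
  induction k using Nat.strong_induction_on with
  | _ k ih =>
    intro hkd
    rcases Nat.eq_zero_or_pos k with rfl | hpos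
    · refine ⟨fun _ => ?_, fun h => absurd h (by decide)⟩
      rw [esymm_zero]
      exact A.one_mem
    have hk0 : (k : ℂ) ≠ 0 := Nat.cast_ne_zero.mpr hpos.ne'
    have key := MvPolynomial.mul_esymm_eq_sum (Fin m) ℂ k
    have hCk : esymm (Fin m) ℂ k = (k : ℂ)⁻¹ • ((k : MvPolynomial (Fin m) ℂ) * esymm (Fin m) ℂ k) := by
      rw [smul_eq_C_mul, ← mul_assoc, show (k : MvPolynomial (Fin m) ℂ) = C (k : ℂ) from (map_natCast C k).symm,
        ← map_mul, inv_mul_cancel₀ hk0, C_1, one_mul]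
    constructor
    · -- `k` even
      intro hkeven
      rw [hCk, key]
      refine A.smul_mem (A.mul_mem (A.pow_mem (A.neg_mem A.one_mem) _) (A.sum_mem fun a ha => ?_)) _
      rw [Finset.mem_filter, Finset.HasAntidiagonal.mem_antidiagonal] at ha
      obtain ⟨hab, halt⟩ := ha
      have hka : Even (a.1 + a.2) := by rw [hab]; exact hkeven
      rcases Nat.even_or_odd a.1 with h1 | h1
      · have h2 : Even a.2 := (Nat.even_add.mp hka).mp h1
        have h2pos : 1 ≤ a.2 := by omega
        exact A.mul_mem (A.mul_mem (A.pow_mem (A.neg_mem A.one_mem) _) (((ih a.1 halt) (by omega)).1 h1))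
          (hE a.2 h2 h2pos (by omega))
      · have h2 : Odd a.2 := (Nat.even_add'.mp hka).mp h1
        rw [mul_assoc]
        exact A.mul_mem (A.pow_mem (A.neg_mem A.one_mem) _)
          (oddSpan_mul_psum_odd A hP (((ih a.1 halt) (by omega)).2 h1) h2 (by omega))
    · -- `k` odd
      intro hkodd
      rw [hCk, key]
      refine Submodule.smul_mem _ _ (neg_one_pow_mul_mem_submodule _ _ (Submodule.sum_mem _ fun a ha => ?_))
      rw [Finset.mem_filter, Finset.HasAntidiagonal.mem_antidiagonal] at ha
      obtain ⟨hab, halt⟩ := ha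
      have hka : Odd (a.1 + a.2) := by rw [hab]; exact hkodd
      rw [mul_assoc]
      refine neg_one_pow_mul_mem_submodule _ _ ?_
      rcases Nat.even_or_odd a.1 with h1 | h1
      · have h2 : Odd a.2 := (Nat.odd_add'.mp hka).mpr h1
        exact Submodule.subset_span ⟨esymm (Fin m) ℂ a.1, ((ih a.1 halt) (by omega)).1 h1, a.2, h2, by omega, rfl⟩
      · have h2 : Even a.2 := (Nat.odd_add.mp hka).mp h1
        have h2pos : 1 ≤ a.2 := by omega
        exact oddSpan_mul_psum_even A hE (((ih a.1 halt) (by omega)).2 h1) h2 h2pos (by omega)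

end ParityNewton

/-! ### Transport to a linear frame -/

/-- **Parity Newton on a frame.**  For a family `v : Fin m → ℂ[x]` and EVEN `d`: `e_d(v)` lies in the subalgebra generated
by the even moments `Σ_i v_i^j` (`j ≤ d` even) and the products `(Σ_i v_i^j)(Σ_i v_i^{j'})` (`j, j' ≤ d` odd). [folklore] -/
theorem esymm_frame_mem_adjoin_evenOdd {m : ℕ} (v : Fin m → MvPolynomial (Fin n × Fin n) ℂ) {d : ℕ} (hd : Even d) :
    ((univ : Finset (Fin m)).val.map v).esymm d ∈ Algebra.adjoin ℂ
      ({q | ∃ j : ℕ, Even j ∧ 1 ≤ j ∧ j ≤ d ∧ q = ∑ i : Fin m, v i ^ j} ∪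
        {q | ∃ j j' : ℕ, Odd j ∧ Odd j' ∧ j ≤ d ∧ j' ≤ d ∧ q = (∑ i : Fin m, v i ^ j) * ∑ i : Fin m, v i ^ j'}) := by
  set B := Algebra.adjoin ℂ
      ({q | ∃ j : ℕ, Even j ∧ 1 ≤ j ∧ j ≤ d ∧ q = ∑ i : Fin m, v i ^ j} ∪
        {q | ∃ j j' : ℕ, Odd j ∧ Odd j' ∧ j ≤ d ∧ j' ≤ d ∧ q = (∑ i : Fin m, v i ^ j) * ∑ i : Fin m, v i ^ j'})
    with hB
  have hps : ∀ j : ℕ, aeval v (psum (Fin m) ℂ j) = ∑ i : Fin m, v i ^ j := fun j => by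
    simp only [psum, map_sum, map_pow, aeval_X]
  have hA := parityNewton (d := d) (B.comap (aeval v))
    (fun j hj hj1 hjd => by
      rw [Subalgebra.mem_comap, hps]
      exact Algebra.subset_adjoin (Or.inl ⟨j, hj, hj1, hjd, rfl⟩))
    (fun j j' hj hj' hjd hj'd => by
      rw [Subalgebra.mem_comap, map_mul, hps, hps]
      exact Algebra.subset_adjoin (Or.inr ⟨j, j', hj, hj', hjd, hj'd, rfl⟩))
    d le_rfl
  have h := (hA.1 hd)
  rw [Subalgebra.mem_comap, MvPolynomial.aeval_esymm_eq_multiset_esymm] at h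
  exact h

/-! ### The derivative chain of a product of two moments -/

/-- The partial derivative of a power of a linear form. [folklore] -/
theorem pderiv_lin_pow (x : Fin n × Fin n) (w : (Fin n × Fin n) → ℂ) (e : ℕ) :
    pderiv x (lin w ^ e) = C ((e : ℂ) * w x) * lin w ^ (e - 1) := by
  have h := pderiv_C_mul_lin_pow x 1 w e
  rwa [map_one, one_mul, one_mul] at h

/-- **The derivative chain of a product of two moments is small.**  For a linear frame `(ℓ_{w_i})_{i<m}` and `j, j'`:
every `derivChain ((Σ_i ℓ_{w_i}^j)(Σ_i ℓ_{w_i}^{j'})) k` lies in `span{ℓ_{w_i}^p ℓ_{w_{i'}}^q : i, i' < m, p ≤ j, q ≤ j'}`.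
[folklore] -/
theorem derivChain_momentProduct_le {m : ℕ} (w : Fin m → (Fin n × Fin n) → ℂ) (j j' : ℕ) :
    ∀ k : ℕ, derivChain ((∑ i : Fin m, lin (w i) ^ j) * ∑ i : Fin m, lin (w i) ^ j') k ≤
      Submodule.span ℂ (Set.range fun t : (Fin m × Fin m) × (Fin (j + 1) × Fin (j' + 1)) =>
        lin (w t.1.1) ^ (t.2.1 : ℕ) * lin (w t.1.2) ^ (t.2.2 : ℕ))
  | 0 => by
      rw [derivChain, Submodule.span_le, Set.singleton_subset_iff, SetLike.mem_coe, Finset.sum_mul_sum]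
      refine Submodule.sum_mem _ fun i _ => Submodule.sum_mem _ fun i' _ => ?_
      exact Submodule.subset_span ⟨((i, i'), (⟨j, by omega⟩, ⟨j', by omega⟩)), rfl⟩
  | k + 1 => by
      rw [derivChain, Submodule.span_le]
      rintro _ ⟨x, p, hp, rfl⟩
      have hmap : (Submodule.span ℂ (Set.range fun t : (Fin m × Fin m) × (Fin (j + 1) × Fin (j' + 1)) =>
          lin (w t.1.1) ^ (t.2.1 : ℕ) * lin (w t.1.2) ^ (t.2.2 : ℕ))).map (pdLin x) ≤
          Submodule.span ℂ (Set.range fun t : (Fin m × Fin m) × (Fin (j + 1) × Fin (j' + 1)) =>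
            lin (w t.1.1) ^ (t.2.1 : ℕ) * lin (w t.1.2) ^ (t.2.2 : ℕ)) := by
        rw [Submodule.map_span_le]
        rintro _ ⟨⟨⟨i, i'⟩, ⟨a, b⟩⟩, rfl⟩
        rw [pdLin_apply]
        simp only []
        rw [pderiv_mul, pderiv_lin_pow, pderiv_lin_pow]
        refine Submodule.add_mem _ ?_ ?_
        · rw [mul_assoc, ← smul_eq_C_mul]
          refine Submodule.smul_mem _ _ (Submodule.subset_span ⟨((i, i'), (⟨(a : ℕ) - 1, by omega⟩, b)), rfl⟩)
        · rw [mul_left_comm, ← smul_eq_C_mul]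
          refine Submodule.smul_mem _ _ (Submodule.subset_span ⟨((i, i'), (a, ⟨(b : ℕ) - 1, by omega⟩)), rfl⟩)
      have := hmap (Submodule.mem_map_of_mem (derivChain_momentProduct_le w j j' k hp))
      rwa [pdLin_apply] at this

/-- Dimension bound: every derivative space of a product of two moments of a linear frame of size `m` (orders `j, j' ≤ m`)
has dimension `≤ (m+1)^4`. [folklore] -/
theorem finrank_derivChain_momentProduct_le {m : ℕ} (w : Fin m → (Fin n × Fin n) → ℂ) {j j' : ℕ}
    (hj : j ≤ m) (hj' : j' ≤ m) (k : ℕ) :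
    FiniteDimensional ℂ (derivChain ((∑ i : Fin m, lin (w i) ^ j) * ∑ i : Fin m, lin (w i) ^ j') k) ∧
      Module.finrank ℂ (derivChain ((∑ i : Fin m, lin (w i) ^ j) * ∑ i : Fin m, lin (w i) ^ j') k) ≤ (m + 1) ^ 4 := by
  have hle := derivChain_momentProduct_le w j j' k
  haveI : FiniteDimensional ℂ (Submodule.span ℂ (Set.range fun t : (Fin m × Fin m) × (Fin (j + 1) × Fin (j' + 1)) =>
      lin (w t.1.1) ^ (t.2.1 : ℕ) * lin (w t.1.2) ^ (t.2.2 : ℕ))) :=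
    FiniteDimensional.span_of_finite ℂ (Set.finite_range _)
  refine ⟨Submodule.finiteDimensional_of_le hle, (Submodule.finrank_mono hle).trans ?_⟩
  refine (finrank_range_le_card _).trans ?_
  simp only [Fintype.card_prod, Fintype.card_fin]
  calc m * m * ((j + 1) * (j' + 1)) ≤ (m + 1) * (m + 1) * ((m + 1) * (m + 1)) := by gcongr <;> omega
    _ = (m + 1) ^ 4 := by ring

/-- A product of two moments of a LINEAR frame is homogeneous. [folklore] -/
theorem isHomogeneous_momentProduct {m : ℕ} (w : Fin m → (Fin n × Fin n) → ℂ) (j j' : ℕ) :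
    ((∑ i : Fin m, lin (w i) ^ j) * ∑ i : Fin m, lin (w i) ^ j').IsHomogeneous (j + j') := by
  refine IsHomogeneous.mul ?_ ?_
  · refine IsHomogeneous.sum _ _ _ fun i _ => ?_
    simpa using (isHomogeneous_lin (w i)).pow j
  · refine IsHomogeneous.sum _ _ _ fun i _ => ?_
    simpa using (isHomogeneous_lin (w i)).pow j'

/-- **A matrix-symmetric product of two moments of a linear frame restores, uniformly.**  For every `c` there is `K` such
that at every level `n`, for every linear frame of size `m` with `(m+1)^4 ≤ n^c + c` and `j, j' ≤ m`: if
`(Σ_i ℓ_{w_i}^j)(Σ_i ℓ_{w_i}^{j'})` is matrix-symmetric then it is `QPOrbitRestorable K n` (polynomial catalecticant rank,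
`DerivativeTower.qpOrbitRestorable_of_smallDerivChain`, unconditional via `AltFix.smallModules_altSpanning`). [folklore] -/
theorem qpOrbitRestorable_momentProduct (c : ℕ) : ∃ K : ℕ, ∀ (n m : ℕ) (w : Fin m → (Fin n × Fin n) → ℂ) (j j' : ℕ),
    (m + 1) ^ 4 ≤ n ^ c + c → j ≤ m → j' ≤ m →
    (∀ σ τ : Perm (Fin n), rename (fun q : Fin n × Fin n => (σ q.1, τ q.2))
      ((∑ i : Fin m, lin (w i) ^ j) * ∑ i : Fin m, lin (w i) ^ j') =
        (∑ i : Fin m, lin (w i) ^ j) * ∑ i : Fin m, lin (w i) ^ j') →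
    QPOrbitRestorable K n ((∑ i : Fin m, lin (w i) ^ j) * ∑ i : Fin m, lin (w i) ^ j') := by
  obtain ⟨k, n₀, hk⟩ := AltFix.smallModules_altSpanning c
  refine ⟨max (k + 7) (n₀.factorial + 5), fun n m w j j' hm hj hj' hsym => ?_⟩
  have hsym' : ∀ σ τ : Perm (Fin n), mact σ τ ((∑ i : Fin m, lin (w i) ^ j) * ∑ i : Fin m, lin (w i) ^ j') =
      (∑ i : Fin m, lin (w i) ^ j) * ∑ i : Fin m, lin (w i) ^ j' := by
    intro σ τ
    rw [mact_apply]
    exact hsym σ τ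
  by_cases hn : n₀ ≤ n
  · refine Restorable.qpOrbitRestorable_mono (le_max_left _ _) ?_
    exact DerivativeTower.qpOrbitRestorable_of_smallDerivChain (k := k) (r := (m + 1) ^ 4) (d := j + j')
      (fun W hW hdim hst => hk n hn W hW (hdim.trans hm) fun ρ w' hw' => by
        rw [ren_eq_mact]; exact hst ρ ρ w' hw')
      (isHomogeneous_momentProduct w j j') (finrank_derivChain_momentProduct_le w hj hj') hsym'
  · refine Restorable.qpOrbitRestorable_mono ?_ (Restorable.qpOrbitRestorable_of_invariant _ fun σ => ?_)
    · have h1 : n.factorial ≤ n₀.factorial := Nat.factorial_le (by omega)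
      exact (Nat.add_le_add_right h1 5).trans (le_max_right _ _)
    · rw [ren_eq_mact]
      exact hsym' σ σ

/-! ### Sign-twisted frames restore -/

/-- ★ **SIGN-TWISTED LINEAR FRAMES RESTORE (even degree, unconditionally, uniform constant).**  For every `c` there is `c'`
such that at every level `n`, for every linear frame `Λ = (ℓ_{w_i})_{i<m}` with `(m+1)^4 ≤ n^c + c`, every EVEN `d` and
every `a`: if the even moments `p_j(Λ)` (`j ≤ d` even) and the products of odd moments `p_j(Λ)·p_{j'}(Λ)` (`j, j' ≤ d` odd)
are matrix-symmetric, then `a · e_d(Λ)` is `QPOrbitRestorable c' n`.  No odd moment needs to be invariant: frames on which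
`Sym_n × Sym_n` acts through a `±1`-valued character qualify. [folklore; cite: Shpilka2002, Thm 3.1] -/
theorem qpOrbitRestorable_esymm_of_evenOddMoments (c : ℕ) : ∃ c' : ℕ, ∀ (n m : ℕ)
    (w : Fin m → (Fin n × Fin n) → ℂ) (a : ℂ) (d : ℕ), (m + 1) ^ 4 ≤ n ^ c + c → Even d →
    (∀ j : ℕ, Even j → 1 ≤ j → j ≤ d → ∀ σ τ : Perm (Fin n),
      rename (fun q : Fin n × Fin n => (σ q.1, τ q.2)) (∑ i : Fin m, lin (w i) ^ j) = ∑ i : Fin m, lin (w i) ^ j) →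
    (∀ j j' : ℕ, Odd j → Odd j' → j ≤ d → j' ≤ d → ∀ σ τ : Perm (Fin n),
      rename (fun q : Fin n × Fin n => (σ q.1, τ q.2))
        ((∑ i : Fin m, lin (w i) ^ j) * ∑ i : Fin m, lin (w i) ^ j') =
          (∑ i : Fin m, lin (w i) ^ j) * ∑ i : Fin m, lin (w i) ^ j') →
    QPOrbitRestorable c' n (C a * (((univ : Finset (Fin m)).val.map fun i => lin (w i)).esymm d)) := by
  obtain ⟨K₁, hK₁⟩ := qpOrbitRestorable_moment c
  obtain ⟨K₂, hK₂⟩ := qpOrbitRestorable_momentProduct c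
  refine ⟨max K₁ K₂ + 3, fun n m w a d hm hd hE hP => ?_⟩
  have hm1 : m ≤ n ^ c + c := by
    calc m ≤ m + 1 := Nat.le_succ m
      _ ≤ (m + 1) ^ 4 := Nat.le_self_pow (by norm_num) _
      _ ≤ n ^ c + c := hm
  by_cases hdm : d ≤ m
  · have hT : ∀ t ∈ ({q | ∃ j : ℕ, Even j ∧ 1 ≤ j ∧ j ≤ d ∧ q = ∑ i : Fin m, lin (w i) ^ j} ∪
        {q | ∃ j j' : ℕ, Odd j ∧ Odd j' ∧ j ≤ d ∧ j' ≤ d ∧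
          q = (∑ i : Fin m, lin (w i) ^ j) * ∑ i : Fin m, lin (w i) ^ j'}), QPOrbitRestorable (max K₁ K₂) n t := by
      rintro t (⟨j, hj, hj1, hjd, rfl⟩ | ⟨j, j', hj, hj', hjd, hj'd, rfl⟩)
      · refine Restorable.qpOrbitRestorable_mono (le_max_left _ _) ?_
        have h := hK₁ n m w (fun _ => 0) j hm1
        simp only [map_zero, add_zero] at h
        exact h (hE j hj hj1 hjd)
      · exact Restorable.qpOrbitRestorable_mono (le_max_right _ _)
          (hK₂ n m w j j' hm (hjd.trans hdm) (hj'd.trans hdm) (hP j j' hj hj' hjd hj'd))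
    have hmem : C a * (((univ : Finset (Fin m)).val.map fun i => lin (w i)).esymm d) ∈ Algebra.adjoin ℂ
        ({q | ∃ j : ℕ, Even j ∧ 1 ≤ j ∧ j ≤ d ∧ q = ∑ i : Fin m, lin (w i) ^ j} ∪
          {q | ∃ j j' : ℕ, Odd j ∧ Odd j' ∧ j ≤ d ∧ j' ≤ d ∧
            q = (∑ i : Fin m, lin (w i) ^ j) * ∑ i : Fin m, lin (w i) ^ j'}) :=
      Subalgebra.mul_mem _ (Subalgebra.algebraMap_mem _ _) (esymm_frame_mem_adjoin_evenOdd (fun i => lin (w i)) hd)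
    exact RowColumnRestorable.qpOrbitRestorable_of_mem_adjoin hT hmem
  · have h0 : (((univ : Finset (Fin m)).val.map fun i => lin (w i)).esymm d) = 0 := by
      rw [Multiset.esymm, Multiset.powersetCard_eq_empty d
        (by rw [Multiset.card_map, Finset.card_val, Finset.card_univ, Fintype.card_fin]; omega)]
      simp
    rw [h0, mul_zero]
    exact RowColumnRestorable.qpOrbitRestorable_of_mem_adjoin (c := max K₁ K₂) (n := n)
      (T := (∅ : Set (MvPolynomial (Fin n × Fin n) ℂ))) (fun t ht => absurd ht (Set.notMem_empty t))
      (p := 0) (Subalgebra.zero_mem _)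

/-! ### v2 — the usual frame budget `m ≤ n^c + c` -/

/-- Budget bookkeeping: `(n^c + c + 1)^4 ≤ n^{(c+2)^4} + (c+2)^4`. [folklore] -/
theorem pbound_succ_pow_four (n c : ℕ) : (n ^ c + c + 1) ^ 4 ≤ n ^ ((c + 2) ^ 4) + (c + 2) ^ 4 := by
  have hc4 : 4 * c + 4 ≤ (c + 2) ^ 4 := by
    have h1 : 4 * c + 4 ≤ (c + 2) ^ 2 := by nlinarith
    calc 4 * c + 4 ≤ (c + 2) ^ 2 := h1
      _ ≤ (c + 2) ^ 4 := Nat.pow_le_pow_right (by omega) (by norm_num)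
  rcases Nat.lt_or_ge n 2 with hn | hn
  · interval_cases n
    · -- n = 0
      rcases Nat.eq_zero_or_pos c with rfl | hc
      · norm_num
      · rw [zero_pow (by omega), zero_pow (by positivity)]
        have : (0 + c + 1) ^ 4 ≤ (c + 2) ^ 4 := Nat.pow_le_pow_left (by omega) 4
        omega
    · -- n = 1
      rw [one_pow, one_pow]
      have : (1 + c + 1) ^ 4 = (c + 2) ^ 4 := by ring
      omega
  · have h2c : c + 1 ≤ n ^ c := by
      calc c + 1 ≤ 2 ^ c := Nat.lt_two_pow_self
        _ ≤ n ^ c := Nat.pow_le_pow_left hn c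
    have h3 : n ^ c + c + 1 ≤ n ^ (c + 1) := by
      calc n ^ c + c + 1 ≤ n ^ c + n ^ c := by omega
        _ = 2 * n ^ c := by ring
        _ ≤ n * n ^ c := Nat.mul_le_mul_right _ hn
        _ = n ^ (c + 1) := by ring
    calc (n ^ c + c + 1) ^ 4 ≤ (n ^ (c + 1)) ^ 4 := Nat.pow_le_pow_left h3 4
      _ = n ^ (4 * c + 4) := by rw [← pow_mul]; ring_nf
      _ ≤ n ^ ((c + 2) ^ 4) := Nat.pow_le_pow_right (by omega) hc4
      _ ≤ n ^ ((c + 2) ^ 4) + (c + 2) ^ 4 := Nat.le_add_right _ _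

/-- ★ **SIGN-TWISTED LINEAR FRAMES RESTORE — usual budget.**  As `qpOrbitRestorable_esymm_of_evenOddMoments`, for every
linear frame of at most `n^c + c` forms. [folklore; cite: Shpilka2002, Thm 3.1] -/
theorem qpOrbitRestorable_esymm_of_evenOddMoments' (c : ℕ) : ∃ c' : ℕ, ∀ (n m : ℕ)
    (w : Fin m → (Fin n × Fin n) → ℂ) (a : ℂ) (d : ℕ), m ≤ n ^ c + c → Even d →
    (∀ j : ℕ, Even j → 1 ≤ j → j ≤ d → ∀ σ τ : Perm (Fin n),
      rename (fun q : Fin n × Fin n => (σ q.1, τ q.2)) (∑ i : Fin m, lin (w i) ^ j) = ∑ i : Fin m, lin (w i) ^ j) →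
    (∀ j j' : ℕ, Odd j → Odd j' → j ≤ d → j' ≤ d → ∀ σ τ : Perm (Fin n),
      rename (fun q : Fin n × Fin n => (σ q.1, τ q.2))
        ((∑ i : Fin m, lin (w i) ^ j) * ∑ i : Fin m, lin (w i) ^ j') =
          (∑ i : Fin m, lin (w i) ^ j) * ∑ i : Fin m, lin (w i) ^ j') →
    QPOrbitRestorable c' n (C a * (((univ : Finset (Fin m)).val.map fun i => lin (w i)).esymm d)) := by
  obtain ⟨c', hc'⟩ := qpOrbitRestorable_esymm_of_evenOddMoments ((c + 2) ^ 4)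
  refine ⟨c', fun n m w a d hm hd hE hP => hc' n m w a d ?_ hd hE hP⟩
  calc (m + 1) ^ 4 ≤ (n ^ c + c + 1) ^ 4 := Nat.pow_le_pow_left (by omega) 4
    _ ≤ n ^ ((c + 2) ^ 4) + (c + 2) ^ 4 := pbound_succ_pow_four n c

end SymmetricModel

end OrbitRestorationQPDepthThreeRung

end Summit.ValiantsHypothesis.ValiantsHypothesis.Theorems

end
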